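import Mathlib
import Summits.Ventures.PercRepro2.LocRows
import Summits.Ventures.PercRepro2.SwRow
import Summits.Ventures.PercRepro2.SwOut
import Summits.Ventures.PercRepro2.SwAllRow
import Summits.Ventures.PercRepro2.SwOutAll
import Summits.Ventures.PercRepro2.SwOutArmFlip
import Summits.Ventures.PercRepro2.SwOutArmThm
import Summits.Ventures.PercRepro2.SwOutJunction
import Summits.Ventures.PercRepro2.SwOutJunctionRegion
import Summits.Ventures.PercRepro2.SwOutCoreDefs
import Summits.Ventures.PercRepro2.SwOutCoreKey
import Summits.Ventures.PercRepro2.SwOutJunctionH1Defs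
import Summits.Ventures.PercRepro2.SwOutJunctionH1Arms

/-!
# The (H1) single junction: the arms cover the extended hull, each on one side, and an h-arm is
adjacent to `u` (blind cell PercRepro2, night-4 g13, 2026-08-26; proofs/NIGHT4-G13.md §4 (C1))

Three closure arguments on a configuration `η` with the extended hull `H⁺`: every vertex of
`H⁺ ∖ {h, u}` lies in an arm reached from `h` or from `u` (`exists_armsC_of_mem`: a red cluster
rooted at `h` or `u` is closed under red adjacency into the arms); an arm lies in the red side or
in the blue side when no edge joins the two sides (`armsC_subset_side`); when `u` lies in the red
cluster of `h`, some arm adjacent to `u` by a red edge contains a neighbour of `h`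
(`exists_harm_adj_u`: a red path from `h` to `u` enters `u` from a vertex red-connected to `h`
without using `u`, whose arm carries the second vertex of that path).  The blue statements are the
red ones for `blue η` (the arms depend on `H⁺` only: `armsC_blue`).
-/

namespace Summit.Ventures.PercRepro2

namespace LocRows

open Hull

variable {V : Type*} {E : Type*} [Fintype E] [DecidableEq E]

open scoped Classical

variable {ends : E → Sym2 V} {h u : V} {η : Config E}

omit [Fintype E] [DecidableEq E] in
/-- The extended hull of the blue colouring. -/
lemma extHull_blue : extHull ends (blue η) h u = extHull ends η h u := by
  simp only [extHull, hull_blue]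

omit [DecidableEq E] in
/-- The arms of the blue colouring. -/
lemma armsC_blue : armsC ends h u (blue η) = armsC ends h u η :=
  armsC_eq_of_extHull_eq extHull_blue

omit [Fintype E] [DecidableEq E] in
/-- A vertex of the red cluster of a root `r ∈ {h, u}`, other than `h` and `u`, lies in the arm of
a vertex joined to `h` or to `u` by an edge. -/
lemma exists_armC_of_mem_red {r : V} (hr : r = h ∨ r = u) {x : V} (hx : x ∈ cluster ends η r)
    (hxh : x ≠ h) (hxu : x ≠ u) :
    ∃ y e, (ends e = s(h, y) ∨ ends e = s(u, y)) ∧ y ≠ h ∧ y ≠ u ∧ y ∈ extHull ends η h u ∧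
      x ∈ armC ends h u η y := by
  have hrH : ∀ v, v ∈ cluster ends η r → v ∈ extHull ends η h u := by
    intro v hv
    rcases hr with rfl | rfl
    · exact Or.inl (Or.inl hv)
    · exact Or.inr (Or.inl hv)
  let S : Set V := {v | v ∈ cluster ends η r ∧ (v = h ∨ v = u ∨ ∃ y e,
    (ends e = s(h, y) ∨ ends e = s(u, y)) ∧ y ≠ h ∧ y ≠ u ∧ y ∈ extHull ends η h u ∧
      v ∈ armC ends h u η y)}
  have key : x ∈ S := by
    refine mem_of_conn_of_closed (ends := ends) (ω := η) ?_ ⟨mem_cluster_self _ _ _, ?_⟩ hx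
    · intro a ha b hab
      obtain ⟨hne, e, he, hends⟩ := openGraph_adj.1 hab
      have hbr : b ∈ cluster ends η r := mem_cluster_of_edge ha.1 he hends
      refine ⟨hbr, ?_⟩
      by_cases hbh : b = h
      · exact Or.inl hbh
      by_cases hbu : b = u
      · exact Or.inr (Or.inl hbu)
      have hbH : b ∈ extHull ends η h u := hrH b hbr
      rcases ha.2 with rfl | rfl | ⟨y, e', he', hyh, hyu, hyH, hay⟩
      · exact Or.inr (Or.inr ⟨b, e, Or.inl hends, hbh, hbu, hbH, mem_armC_self b⟩)
      · exact Or.inr (Or.inr ⟨b, e, Or.inr hends, hbh, hbu, hbH, mem_armC_self b⟩)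
      · have haH' := armC_subset hyH hyh hyu hay
        simp only [Set.mem_sdiff, Set.mem_insert_iff, Set.mem_singleton_iff, not_or] at haH'
        exact Or.inr (Or.inr ⟨y, e', he', hyh, hyu, hyH,
          mem_armC_of_edge hay haH'.1 haH'.2.1 haH'.2.2 hbH hbh hbu hends⟩)
    · rcases hr with rfl | rfl
      · exact Or.inl rfl
      · exact Or.inr (Or.inl rfl)
  rcases key.2 with h' | h' | h'
  · exact absurd h' hxh
  · exact absurd h' hxu
  · exact h'

omit [DecidableEq E] in
/-- **Every vertex of `H⁺ ∖ {h, u}` lies in an arm.** -/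
theorem exists_armsC_of_mem (hhu : h ≠ u) {x : V} (hxH : x ∈ extHull ends η h u) (hxh : x ≠ h)
    (hxu : x ≠ u) : ∃ P ∈ armsC ends h u η, x ∈ P := by
  -- red or blue, rooted at `h` or at `u`
  have key : ∀ (η' : Config E), extHull ends η' h u = extHull ends η h u →
      ∀ r, (r = h ∨ r = u) → x ∈ cluster ends η' r → ∃ P ∈ armsC ends h u η, x ∈ P := by
    intro η' hH r hr hx
    obtain ⟨y, e, he, hyh, hyu, hyH, hxy⟩ := exists_armC_of_mem_red (η := η') hr hx hxh hxu
    rw [hH] at hyH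
    rw [armC_eq_of_extHull_eq hH] at hxy
    exact ⟨armC ends h u η y, armC_mem_armsC hhu hyH hyh hyu he, hxy⟩
  rcases hxH with (hx | hx) | (hx | hx)
  · exact key η rfl h (Or.inl rfl) hx
  · exact key (blue η) extHull_blue h (Or.inl rfl) hx
  · exact key η rfl u (Or.inr rfl) hx
  · exact key (blue η) extHull_blue u (Or.inr rfl) hx

omit [DecidableEq E] in
/-- **An arm lies on one side** when no edge joins the red side to the blue side. -/
theorem armsC_subset_side
    (hnoRB : ∀ e x y, ends e = s(x, y) → x ∈ redExt ends h u η → y ∈ blueExt ends η h u → False)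
    {P : Set V} (hP : P ∈ armsC ends h u η) :
    P ⊆ redExt ends h u η ∨ P ⊆ blueExt ends η h u := by
  obtain ⟨y, hyH, hyh, hyu, rfl⟩ := exists_of_mem_armsC hP
  -- `y` is on one side
  have hy : y ∈ redExt ends h u η ∨ y ∈ blueExt ends η h u := by
    rw [extHull_eq] at hyH
    rcases hyH with ((rfl | rfl) | hy) | hy
    · exact absurd rfl hyh
    · exact absurd rfl hyu
    · exact Or.inl hy
    · exact Or.inr hy
  -- the side is closed under adjacency inside `H⁺ ∖ {h, u}`
  have hred : ∀ a ∈ redExt ends h u η, ∀ b, (openGraph ends (armConfigC ends h u η)).Adj a b →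
      b ∈ redExt ends h u η := by
    intro a ha b hab
    obtain ⟨_, e, he, hends⟩ := openGraph_adj.1 hab
    obtain ⟨x', hx', y', hy', h'⟩ := armConfigC_eq_true_iff.1 he
    have hbH : b ∈ extHull ends η h u \ {h, u} := by
      rw [hends, Sym2.eq_iff] at h'
      rcases h' with ⟨_, rfl⟩ | ⟨_, rfl⟩
      · exact hy'
      · exact hx'
    have hbH' : b ∈ redExt ends h u η ∨ b ∈ blueExt ends η h u := by
      have := hbH.1
      rw [extHull_eq] at this
      simp only [Set.mem_sdiff, Set.mem_insert_iff, Set.mem_singleton_iff, not_or] at hbH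
      rcases this with ((h1 | h1) | h1) | h1
      · exact absurd h1 hbH.2.1
      · exact absurd h1 hbH.2.2
      · exact Or.inl h1
      · exact Or.inr h1
    rcases hbH' with hb | hb
    · exact hb
    · exact absurd hb (fun hb => hnoRB e a b hends ha hb)
  have hblue : ∀ a ∈ blueExt ends η h u, ∀ b, (openGraph ends (armConfigC ends h u η)).Adj a b →
      b ∈ blueExt ends η h u := by
    intro a ha b hab
    obtain ⟨_, e, he, hends⟩ := openGraph_adj.1 hab
    obtain ⟨x', hx', y', hy', h'⟩ := armConfigC_eq_true_iff.1 he
    have hbH : b ∈ extHull ends η h u \ {h, u} := by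
      rw [hends, Sym2.eq_iff] at h'
      rcases h' with ⟨_, rfl⟩ | ⟨_, rfl⟩
      · exact hy'
      · exact hx'
    have hbH' : b ∈ redExt ends h u η ∨ b ∈ blueExt ends η h u := by
      have := hbH.1
      rw [extHull_eq] at this
      simp only [Set.mem_sdiff, Set.mem_insert_iff, Set.mem_singleton_iff, not_or] at hbH
      rcases this with ((h1 | h1) | h1) | h1
      · exact absurd h1 hbH.2.1
      · exact absurd h1 hbH.2.2
      · exact Or.inl h1
      · exact Or.inr h1
    rcases hbH' with hb | hb
    · exact absurd ha (fun ha => hnoRB e b a (ends_swap hends) hb ha)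
    · exact hb
  rcases hy with hy | hy
  · exact Or.inl fun v hv => mem_of_conn_of_closed hred hy hv
  · exact Or.inr fun v hv => mem_of_conn_of_closed hblue hy hv

/-- The configuration with the edges at `u` deleted. -/
noncomputable def delU (ends : E → Sym2 V) (u : V) (η : Config E) : Config E :=
  fun e => η e && decide (u ∉ ends e)

omit [Fintype E] [DecidableEq E] in
/-- `delU` is below the configuration. -/
lemma delU_le : delU ends u η ≤ η := by
  intro e
  simp only [delU]
  cases η e <;> simp

omit [Fintype E] [DecidableEq E] in
/-- A red edge of `delU` is a red edge of `η` avoiding `u`. -/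
lemma delU_eq_true_iff {e : E} : delU ends u η e = true ↔ η e = true ∧ u ∉ ends e := by
  simp [delU]

omit [Fintype E] [DecidableEq E] in
/-- `u` is not in the `delU`-cluster of `h`. -/
lemma u_notMem_cluster_delU (hhu : h ≠ u) : u ∉ cluster ends (delU ends u η) h := by
  intro hu
  have key : u ∈ {v | v ≠ u} := by
    refine mem_of_conn_of_closed (ends := ends) (ω := delU ends u η) ?_ hhu hu
    intro a _ b hab
    obtain ⟨_, e, he, hends⟩ := openGraph_adj.1 hab
    obtain ⟨_, hue⟩ := delU_eq_true_iff.1 he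
    intro hbu
    exact hue (by rw [hends, hbu]; exact Sym2.mem_mk_right _ _)
  exact key rfl

omit [Fintype E] [DecidableEq E] in
/-- **A red path from `h` to `u` enters `u` from a vertex red-connected to `h` without `u`.** -/
lemma exists_red_edge_into_u (hhu : h ≠ u) (hu : u ∈ cluster ends η h) :
    ∃ p ∈ cluster ends (delU ends u η) h, ∃ e, ends e = s(u, p) ∧ η e = true := by
  let S : Set V := cluster ends (delU ends u η) h ∪
    {v | (∃ p ∈ cluster ends (delU ends u η) h, ∃ e, ends e = s(u, p) ∧ η e = true) ∧
      v ∈ cluster ends η u}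
  have key : u ∈ S := by
    refine mem_of_conn_of_closed (ends := ends) (ω := η) ?_ (Or.inl (mem_cluster_self _ _ _)) hu
    intro a ha b hab
    obtain ⟨hne, e, he, hends⟩ := openGraph_adj.1 hab
    rcases ha with ha | ⟨hcond, ha⟩
    · by_cases hue : u ∈ ends e
      · -- the edge is at `u`: `a ≠ u`, so `b = u`
        have hau : a ≠ u := fun h' => u_notMem_cluster_delU hhu (h' ▸ ha)
        have hbu : b = u := by
          rw [hends, Sym2.mem_iff] at hue
          rcases hue with h' | h'
          · exact absurd h'.symm hau
          · exact h'.symm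
        subst hbu
        exact Or.inr ⟨⟨a, ha, e, ends_swap hends, he⟩, mem_cluster_self _ _ _⟩
      · exact Or.inl (mem_cluster_of_edge ha (delU_eq_true_iff.2 ⟨he, hue⟩) hends)
    · exact Or.inr ⟨hcond, mem_cluster_of_edge ha he hends⟩
  rcases key with hk | ⟨hcond, _⟩
  · exact absurd hk (u_notMem_cluster_delU hhu)
  · exact hcond

omit [Fintype E] [DecidableEq E] in
/-- A vertex red-connected to `h` without `u`, other than `h`, lies in the arm of a neighbour of
`h` (other than `u`). -/
lemma exists_harm_of_mem_cluster_delU (hhu : h ≠ u) {p : V}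
    (hp : p ∈ cluster ends (delU ends u η) h) (hph : p ≠ h) :
    ∃ y e, ends e = s(h, y) ∧ y ≠ h ∧ y ≠ u ∧ y ∈ extHull ends η h u ∧
      p ∈ armC ends h u η y := by
  let S : Set V := {v | v ∈ cluster ends (delU ends u η) h ∧ (v = h ∨ ∃ y e, ends e = s(h, y) ∧
    y ≠ h ∧ y ≠ u ∧ y ∈ extHull ends η h u ∧ v ∈ armC ends h u η y)}
  have key : p ∈ S := by
    refine mem_of_conn_of_closed (ends := ends) (ω := delU ends u η) ?_
      ⟨mem_cluster_self _ _ _, Or.inl rfl⟩ hp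
    intro a ha b hab
    obtain ⟨hne, e, he, hends⟩ := openGraph_adj.1 hab
    obtain ⟨hred, hue⟩ := delU_eq_true_iff.1 he
    have hbd : b ∈ cluster ends (delU ends u η) h := mem_cluster_of_edge ha.1 he hends
    refine ⟨hbd, ?_⟩
    have hbu : b ≠ u := fun h' => hue (by rw [hends, h']; exact Sym2.mem_mk_right _ _)
    have hbH : b ∈ extHull ends η h u :=
      Or.inl (Or.inl (cluster_mono delU_le h hbd))
    by_cases hbh : b = h
    · exact Or.inl hbh
    rcases ha.2 with rfl | ⟨y, e', he', hyh, hyu, hyH, hay⟩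
    · exact Or.inr ⟨b, e, hends, hbh, hbu, hbH, mem_armC_self b⟩
    · have haH' := armC_subset hyH hyh hyu hay
      simp only [Set.mem_sdiff, Set.mem_insert_iff, Set.mem_singleton_iff, not_or] at haH'
      exact Or.inr ⟨y, e', he', hyh, hyu, hyH,
        mem_armC_of_edge hay haH'.1 haH'.2.1 haH'.2.2 hbH hbh hbu hends⟩
  rcases key.2 with h' | h'
  · exact absurd h' hph
  · exact h'

omit [DecidableEq E] in
/-- **When `u` is in the red cluster of `h`, an arm containing a neighbour of `h` is joined to `u`
by a red edge.** -/
theorem exists_harm_adj_u (hhu : h ≠ u) (hnadj : ∀ e, ends e ≠ s(h, u))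
    (hu : u ∈ cluster ends η h) :
    ∃ P ∈ armsC ends h u η, (∃ e y, ends e = s(h, y) ∧ y ∈ P) ∧
      ∃ e x, ends e = s(u, x) ∧ η e = true ∧ x ∈ P := by
  obtain ⟨p, hp, e, hup, hred⟩ := exists_red_edge_into_u hhu hu
  have hpu : p ≠ u := fun h' => u_notMem_cluster_delU hhu (h' ▸ hp)
  have hph : p ≠ h := fun h' => hnadj e (by rw [hup, h']; exact Sym2.eq_swap)
  have hpH : p ∈ extHull ends η h u := Or.inl (Or.inl (cluster_mono delU_le h hp))
  obtain ⟨y, e', he', hyh, hyu, hyH, hpy⟩ := exists_harm_of_mem_cluster_delU hhu hp hph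
  refine ⟨armC ends h u η p, armC_mem_armsC hhu hpH hph hpu (Or.inr hup), ⟨e', y, he', ?_⟩,
    e, p, hup, hred, mem_armC_self p⟩
  rw [armC_eq_of_mem hpy]
  exact mem_armC_self y

end LocRows

end Summit.Ventures.PercRepro2
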